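import Mathlib
import Literature.Analysis.FluidPDE.LocalTypeI
import HarnessLib

/-!
# ConservativeEngine — ATOM SWAP kernel (W3 of cell decomp-ns, node N30ᵃ): the endpoint `ρ = 1/2` of the
# power-zoom cover deposits a TERMINAL ENERGY ATOM

Writer port (decomp-ns-writer-1 g9) of the two kernel lemmas of decomp-ns lens 6, generation 26, `AtomSwap.lean`
(sha256 0a7eb3b0…57c0; CRITIC-LEDGER row 278 CLEARED (KERNEL), booking recommendation (i): «land
FloorForcesGaugedEnergy's statement + endpoint_absurd + atom_of_endpointPowerZoom def-free as --supports 27529 now»).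
Helper for route `ConservativeEngine` (crux `ConservativePowerGaugeEulerLiouville`, stmt-NavierStokesRegularity-27529);
NO item is closed and Navier–Stokes regularity is NOT proved by anything here.  No new definitions, no type-class
declarations, no notation; imports are route-independent (Literature + Mathlib only), so the route file may import
this module.

THE MOVE (lens docstring, abridged).  Route `ConservativeEngine` (N30, rev 3) closes Clay (A) from the engine
X_Eᶜ (27529) ∧ the cover `Cov` (19833) ∧ P1 `NoTypeIBlowup` (1217) with the proved supports Zᶜ/BM.  `Cov` hands over
a power-zoom exponent `ρ ∈ (0, 1/2]`.  At the ENDPOINT `ρ = 1/2` (the energy-conserving scaling) no zoom is needed: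
the provable support `FloorForcesGaugedEnergy` (Cov's cubic floor + the A/E power gauge ⇒ persisting gauged ball
energy `η₀ ≤ r^{2ρ-1} ∫_{B_r(x₀)} |w(s)|²` along `r → 0`, `s ↑ νT`) has weight `r⁰ = 1` there, i.e. the
viscosity-normalised field `w(s,y) = ν⁻¹ u(s/ν, y)` keeps ball energy `≥ η₀` in arbitrarily small balls arbitrarily
late — a TERMINAL ENERGY ATOM of size `≥ η₀ ν²` at `x₀` for `u`, which is exactly what the forest's cell P2
`NoEnergyAtom` (stmt-NavierStokesRegularity-24827) forbids.  This file proves the two pure-rescaling lemmas: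

* `endpoint_absurd` — P2's conclusion for `u` at `x₀` (`∀ η > 0 ∃ r > 0, eventually as t ↑ T, ∫_{B_r(x₀)}|u(t)|² < η`)
  is incompatible with persisting ball energy `≥ η₀` of `ν⁻¹ • u(s/ν, ·)` along `r → 0`, `s ↑ νT`
  (`‖ν⁻¹ • v‖ₑ = ‖ν⁻¹‖ₑ‖v‖ₑ`, `‖ν⁻¹‖‖ν‖ = 1`, `t = s/ν`);
* `endpoint_atom_absurd` — the same from the WEIGHTED persistence `η₀ ≤ r^{2ρ-1} ∫ …` at `ρ = 1/2` (weight `= 1`);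
* `atom_of_endpointPowerZoom` — INSTRUMENT: with the support's statement as a hypothesis-shaped binder (def-free),
  an endpoint power-zoomable blow-up (Cov's second branch at `ρ = 1/2`, in the normalised variables around `(νT, x₀)`)
  makes P2's conclusion for `u` at `x₀` fail.

The route-level use (W3 re-glue `closes hXEi hZc hBM hAtom hCov hP1 hP2`) is a separate ledger edit.  Rung 0.
-/

-- the summit and its single sub-problem share the name (CONVENTIONS §1), as in every Theorems file
set_option linter.dupNamespace false

open scoped NNReal ENNReal Topology
open MeasureTheory Literature.Analysis.FluidPDE

namespace Summit.NavierStokesRegularity.NavierStokesRegularity.Theorems.ConservativeEngine.AtomSwapKernel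

/-- **The endpoint kernel.**  Persisting ball energy `≥ η₀` of the rescaled field `w(s, y) = ν⁻¹ u(s/ν, y)` along
`r → 0`, `s ↑ νT` contradicts P2's conclusion for `u` at `x₀` (pure rescaling `‖ν⁻¹ • v‖ₑ = ‖ν⁻¹‖ₑ ‖v‖ₑ`,
`‖ν⁻¹‖ ‖ν‖ = 1`, `t = s/ν`). [folklore] -/
theorem endpoint_absurd {ν T : ℝ} (hν : 0 < ν)
    {u : ℝ → EuclideanSpace ℝ (Fin 3) → EuclideanSpace ℝ (Fin 3)} {x₀ : EuclideanSpace ℝ (Fin 3)}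
    (hP2x : ∀ η : ℝ≥0, 0 < η → ∃ r : ℝ, 0 < r ∧ ∀ᶠ t in 𝓝[<] T,
      ∫⁻ x in Metric.ball x₀ r, ‖u t x‖ₑ ^ 2 < (η : ℝ≥0∞))
    {η₀ : ℝ≥0} (hη₀ : 0 < η₀)
    (hgood : ∀ R : ℝ, 0 < R → ∀ s₁ : ℝ, s₁ < ν * T → ∃ r ∈ Set.Ioo 0 R, ∃ s ∈ Set.Ioo s₁ (ν * T),
      (η₀ : ℝ≥0∞) ≤ ∫⁻ x in Metric.ball x₀ r, ‖ν⁻¹ • u (s / ν) x‖ₑ ^ 2) : False := by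
  have hνn : 0 < ‖ν‖₊ := nnnorm_pos.2 hν.ne'
  obtain ⟨R, hR, hev⟩ := hP2x (η₀ * ‖ν‖₊ ^ 2) (mul_pos hη₀ (pow_pos hνn 2))
  obtain ⟨t₀, ht₀, hsub⟩ := mem_nhdsLT_iff_exists_Ioo_subset.1 hev
  obtain ⟨r, hr, s, hs, hle⟩ := hgood R hR (ν * t₀) (mul_lt_mul_of_pos_left ht₀ hν)
  have ht : s / ν ∈ Set.Ioo t₀ T :=
    ⟨by rw [lt_div_iff₀ hν]; linarith [hs.1], by rw [div_lt_iff₀ hν]; linarith [hs.2]⟩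
  have hlt : ∫⁻ x in Metric.ball x₀ R, ‖u (s / ν) x‖ₑ ^ 2 < ((η₀ * ‖ν‖₊ ^ 2 : ℝ≥0) : ℝ≥0∞) := hsub ht
  have hmono : ∫⁻ x in Metric.ball x₀ r, ‖ν⁻¹ • u (s / ν) x‖ₑ ^ 2 ≤
      ∫⁻ x in Metric.ball x₀ R, ‖ν⁻¹ • u (s / ν) x‖ₑ ^ 2 :=
    lintegral_mono_set (Metric.ball_subset_ball hr.2.le)
  have hCtop : ‖(ν⁻¹ : ℝ)‖ₑ ^ 2 ≠ ⊤ := ENNReal.pow_ne_top enorm_ne_top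
  have hC0 : ‖(ν⁻¹ : ℝ)‖ₑ ^ 2 ≠ 0 := pow_ne_zero _ (by simpa using inv_ne_zero hν.ne')
  have hscale : ∫⁻ x in Metric.ball x₀ R, ‖ν⁻¹ • u (s / ν) x‖ₑ ^ 2 =
      ‖(ν⁻¹ : ℝ)‖ₑ ^ 2 * ∫⁻ x in Metric.ball x₀ R, ‖u (s / ν) x‖ₑ ^ 2 := by
    simp_rw [enorm_smul, mul_pow]
    exact lintegral_const_mul' _ _ hCtop
  have hkey : ‖(ν⁻¹ : ℝ)‖ₑ ^ 2 * ((η₀ * ‖ν‖₊ ^ 2 : ℝ≥0) : ℝ≥0∞) = (η₀ : ℝ≥0∞) := by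
    rw [enorm_eq_nnnorm, ← ENNReal.coe_pow, ← ENNReal.coe_mul]
    congr 1
    have h1 : ‖(ν⁻¹ : ℝ)‖₊ * ‖ν‖₊ = 1 := by rw [← nnnorm_mul, inv_mul_cancel₀ hν.ne', nnnorm_one]
    calc ‖(ν⁻¹ : ℝ)‖₊ ^ 2 * (η₀ * ‖ν‖₊ ^ 2) = η₀ * (‖(ν⁻¹ : ℝ)‖₊ * ‖ν‖₊) ^ 2 := by ring
      _ = η₀ := by rw [h1]; ring
  have : (η₀ : ℝ≥0∞) < η₀ :=
    calc (η₀ : ℝ≥0∞) ≤ _ := hle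
      _ ≤ _ := hmono
      _ = _ := hscale
      _ < ‖(ν⁻¹ : ℝ)‖ₑ ^ 2 * ((η₀ * ‖ν‖₊ ^ 2 : ℝ≥0) : ℝ≥0∞) :=
        ENNReal.mul_lt_mul_right hC0 hCtop hlt
      _ = η₀ := hkey
  exact lt_irrefl _ this

/-- **The endpoint kernel, weighted form.**  At the energy-conserving exponent `ρ = 1/2` the gauge weight
`r^{2ρ-1}` is `1`, so WEIGHTED persisting ball energy of the normalised field (the conclusion instance of the
support `FloorForcesGaugedEnergy`) already contradicts P2's conclusion for `u` at `x₀`. [folklore] -/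
theorem endpoint_atom_absurd {ν T ρ : ℝ} (hν : 0 < ν) (heq : ρ = 1 / 2)
    {u : ℝ → EuclideanSpace ℝ (Fin 3) → EuclideanSpace ℝ (Fin 3)} {x₀ : EuclideanSpace ℝ (Fin 3)}
    (hgood : ∃ η₀ : ℝ≥0, 0 < η₀ ∧ ∀ R : ℝ, 0 < R → ∀ s₁ : ℝ, s₁ < (ν * T, x₀).1 →
      ∃ r ∈ Set.Ioo 0 R, ∃ s ∈ Set.Ioo s₁ (ν * T, x₀).1,
        (η₀ : ℝ≥0∞) ≤ ENNReal.ofReal (r ^ (2 * ρ - 1)) *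
          ∫⁻ x in Metric.ball (ν * T, x₀).2 r, ‖(fun s y => ν⁻¹ • u (s / ν) y) s x‖ₑ ^ 2)
    (hP2x : ∀ η : ℝ≥0, 0 < η → ∃ r : ℝ, 0 < r ∧ ∀ᶠ t in 𝓝[<] T,
      ∫⁻ x in Metric.ball x₀ r, ‖u t x‖ₑ ^ 2 < (η : ℝ≥0∞)) : False := by
  obtain ⟨η₀, hη₀, hgood⟩ := hgood
  refine endpoint_absurd hν hP2x hη₀ fun R hR s₁ hs₁ => ?_
  obtain ⟨r, hr, s, hs, hle⟩ := hgood R hR s₁ hs₁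
  have hw : ENNReal.ofReal (r ^ (2 * ρ - 1)) = 1 := by
    rw [heq, show (2 : ℝ) * (1 / 2) - 1 = 0 by norm_num, Real.rpow_zero, ENNReal.ofReal_one]
  rw [hw, one_mul] at hle
  exact ⟨r, hr, s, hs, hle⟩

/-- **INSTRUMENT / endpoint discharge** (def-free: the support `FloorForcesGaugedEnergy` of the W3 node enters
as the hypothesis-shaped binder `hAtom`, its statement verbatim).  Given the support, an endpoint (`ρ = 1/2`)
power-zoomable blow-up of `u` at `(T, x₀)` — Cov's second branch, in the viscosity-normalised variables
`w(s, y) = ν⁻¹ u(s/ν, y)` around `(νT, x₀)`: suitable in a parabolic ball, power-gauged, with the cubic floor —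
DEPOSITS A TERMINAL ENERGY ATOM at `x₀`: P2's conclusion (stmt-24827) for `u` at `x₀` fails.  Quantitatively the
atom has size `≥ η₀(ε₀, M) ν²`. [folklore] -/
theorem atom_of_endpointPowerZoom
    (hAtom : ∀ (ρ r₀ : ℝ) (z₀ : ℝ × EuclideanSpace ℝ (Fin 3))
      (w : ℝ → EuclideanSpace ℝ (Fin 3) → EuclideanSpace ℝ (Fin 3)) (q : ℝ → EuclideanSpace ℝ (Fin 3) → ℝ)
      (G : ℝ → EuclideanSpace ℝ (Fin 3) → EuclideanSpace ℝ (Fin 3) →L[ℝ] EuclideanSpace ℝ (Fin 3)),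
      0 < ρ → ρ ≤ 1 / 2 → 0 < r₀ →
      IsSuitableWeakSolutionInBall r₀ z₀ w q →
      HasWeakSpatialGradientOn (parabolicCylinderOpens r₀ z₀) w G →
      (∃ M : ℝ≥0, ∀ r ∈ Set.Ioc 0 r₀,
        ENNReal.ofReal (r ^ (2 * ρ)) * cknA r z₀ w + ENNReal.ofReal (r ^ ρ) * cknE r z₀ G +
          ENNReal.ofReal (r ^ (2 * ρ)) * cknD r z₀ q ≤ (M : ℝ≥0∞)) →
      (∃ ε₀ : ℝ, 0 < ε₀ ∧ ∀ δ : ℝ, 0 < δ → ∃ r ∈ Set.Ioo 0 δ,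
        ENNReal.ofReal ε₀ ≤ ENNReal.ofReal (r ^ (2 * ρ - 2)) *
          ∫⁻ w' in Set.Ioo (z₀.1 - r ^ (2 + ρ)) z₀.1 ×ˢ Metric.ball z₀.2 r, ‖w w'.1 w'.2‖ₑ ^ (3 : ℕ)) →
      ∃ η₀ : ℝ≥0, 0 < η₀ ∧ ∀ R : ℝ, 0 < R → ∀ s₁ : ℝ, s₁ < z₀.1 →
        ∃ r ∈ Set.Ioo 0 R, ∃ s ∈ Set.Ioo s₁ z₀.1,
          (η₀ : ℝ≥0∞) ≤ ENNReal.ofReal (r ^ (2 * ρ - 1)) * ∫⁻ x in Metric.ball z₀.2 r, ‖w s x‖ₑ ^ 2)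
    {ν T ρ r₀ : ℝ} (hν : 0 < ν) (hρ : 0 < ρ) (heq : ρ = 1 / 2) (hr₀ : 0 < r₀)
    {u : ℝ → EuclideanSpace ℝ (Fin 3) → EuclideanSpace ℝ (Fin 3)} {x₀ : EuclideanSpace ℝ (Fin 3)}
    {q : ℝ → EuclideanSpace ℝ (Fin 3) → ℝ}
    {G : ℝ → EuclideanSpace ℝ (Fin 3) → EuclideanSpace ℝ (Fin 3) →L[ℝ] EuclideanSpace ℝ (Fin 3)}
    (hsw : IsSuitableWeakSolutionInBall r₀ (ν * T, x₀) (fun s y => ν⁻¹ • u (s / ν) y) q)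
    (hG : HasWeakSpatialGradientOn (parabolicCylinderOpens r₀ (ν * T, x₀)) (fun s y => ν⁻¹ • u (s / ν) y) G)
    (hM : ∃ M : ℝ≥0, ∀ r ∈ Set.Ioc 0 r₀,
      ENNReal.ofReal (r ^ (2 * ρ)) * cknA r (ν * T, x₀) (fun s y => ν⁻¹ • u (s / ν) y) +
          ENNReal.ofReal (r ^ ρ) * cknE r (ν * T, x₀) G +
        ENNReal.ofReal (r ^ (2 * ρ)) * cknD r (ν * T, x₀) q ≤ (M : ℝ≥0∞))
    (hfloor : ∃ ε₀ : ℝ, 0 < ε₀ ∧ ∀ δ : ℝ, 0 < δ → ∃ r ∈ Set.Ioo 0 δ,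
      ENNReal.ofReal ε₀ ≤ ENNReal.ofReal (r ^ (2 * ρ - 2)) *
        ∫⁻ w in Set.Ioo (ν * T - r ^ (2 + ρ)) (ν * T) ×ˢ Metric.ball x₀ r, ‖(ν⁻¹ • u (w.1 / ν) w.2)‖ₑ ^ (3 : ℕ)) :
    ¬ (∀ η : ℝ≥0, 0 < η → ∃ r : ℝ, 0 < r ∧ ∀ᶠ t in 𝓝[<] T,
        ∫⁻ x in Metric.ball x₀ r, ‖u t x‖ₑ ^ 2 < (η : ℝ≥0∞)) := fun hP2x =>
  endpoint_atom_absurd hν heq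
    (hAtom ρ r₀ (ν * T, x₀) (fun s y => ν⁻¹ • u (s / ν) y) q G hρ (le_of_eq heq) hr₀ hsw hG hM hfloor) hP2x

end Summit.NavierStokesRegularity.NavierStokesRegularity.Theorems.ConservativeEngine.AtomSwapKernel
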